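import Summits.AnomalousDissipation.AnomalousDissipation.Theorems.MomentParityGalerkinEnsembleRealizationStubTimeAverages
import Summits.AnomalousDissipation.AnomalousDissipation.Theorems.MomentParityResolvedDissipationStubLimitLawDefect
import Summits.AnomalousDissipation.AnomalousDissipation.Theorems.MomentParityResolvedDissipationStubRealisedStrictInequality

/-!
# `MomentParity.ResolvedDissipation` (stmt-AnomalousDissipation-14284): bookkeeping for the bridge
# `Correlation.NoMeanLeakage ⟹ ResolvedDissipation` — work and FULL dissipation along the shift

Supports stmt-AnomalousDissipation-14284 (line `enstrophy-ui-transfer`, skeleton v11 of lead c10: proves the registered stub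
S18 `stub_meansOfRealisation` and the bookkeeping behind it; nothing here closes an item).

The Leray–Hopf energy-equality bracket (`Theorems/MomentParityResolvedDissipationOfLerayHopfEnergyEquality`)
lifts a leaking sequence of admissible Galerkin laws to a shift-invariant law `Q` on the compact trajectory space
`𝒦 = pathSpace R L` whose mean unit-window WORK exceeds the mean unit-window resolved dissipation at every
cutoff by a fixed margin. To contradict the weaker, LONG-TIME-AVERAGE statement `Correlation.NoMeanLeakage`
(⟨(f,u)⟩ ≤ ν⟨‖∇u‖²⟩ for every global Leray–Hopf solution) instead of the energy equality between two times,
one needs Birkhoff's pointwise ergodic theorem on `(𝒦, Q, θ)` for two observables and the dictionary between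
their Birkhoff sums and the running time means of a field realising a path. This file supplies that
dictionary:

* the work functional `W(ω) = ∫₀¹ Σ'_k Re⟪𝓕f k, ω̄(t,k)⟫ dt`: bound of the integrand (`abs_workIntegrand_le`),
  the shift identity and the Birkhoff-sum identity `Σ_{i<n} W(θⁱω) = ∫₀ⁿ Σ'_k Re⟪𝓕f k, ω̄(t,k)⟫ dt`
  (`workMean_iterate_pathShift`, `birkhoffSum_workMean`);
* the FULL unit-viscosity dissipation functional `Gₑ(ω) = ⨆_K ofReal (dissMean 1 K ω) ∈ [0, ∞]`
  (`= ∫₀¹ ‖∇u‖² dt` of the path): measurability, `∫⁻ Gₑ dQ = ⨆_K ofReal ∫ dissMean 1 K dQ` (monotone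
  convergence), and the window inequality `⨆_K ofReal ∫₀ᵐ pathDiss 1 K ω ≤ Σ_{i<m} Gₑ(θⁱω)`
  (`iSup_ofReal_intervalIntegral_pathDiss_le_sum`);
* for a field `u` realising `ω` after a shift `s ≥ 0` (`𝓕(u t) = ω̄(s+t, ·)`): the running means of the
  work `∫⟪f, u t⟫` converge to the Birkhoff limit of `W` (`tendsto_timeMean_work`), the running means of
  `ν‖∇u(t)‖₂²` are dominated by `ν T⁻¹ Σ_{i<⌈s+T⌉} Gₑ(θⁱω)` (`timeMean_dissipation_le`), whence S18
  `stub_meansOfRealisation`: `longTimeAvgSup (f, u) = w` and `meanDissipation ν u ≤ ν g` at a generic path.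

References (all folklore bookkeeping): Foias–Manley–Rosa–Temam 2001, Ch. IV App. B; Foias–Rosa–Temam 2013
(arXiv:1111.6257) §3; Dajani–Kalle 2021, Thm 3.1.1 (Birkhoff), Exercise (d) after it (flows via time-one maps).
-/

noncomputable section

set_option linter.dupNamespace false

namespace Summit.AnomalousDissipation.AnomalousDissipation.Theorems.MomentParityResolvedDissipation.NoMeanLeakageBridge

open MeasureTheory Filter Topology Set Function Metric UnitAddTorus
open scoped ENNReal InnerProductSpace RealInnerProductSpace BigOperators
open Literature.Analysis.FunctionSpaces Literature.Analysis.FunctionSpaces.Torus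
open Literature.Analysis.FluidPDE Literature.Analysis.FluidPDE.Torus
open Summit.AnomalousDissipation.AnomalousDissipation.Theorems.MomentParity
open Summit.AnomalousDissipation.AnomalousDissipation.Theorems.MomentParityResolvedDissipation.LhBracket

variable {R : ℝ} {L : (Fin 3 → ℤ) → ℝ} {f : UnitAddTorus (Fin 3) → EuclideanSpace ℝ (Fin 3)}

/-! ### The work functional along the shift -/

/-- **The work integrand is bounded on `𝒦`**: `|Σ'_k Re⟪𝓕f k, ω̄(t,k)⟫| ≤ (Σ'_k ‖𝓕f k‖)·|R|`. -/
theorem abs_workIntegrand_le (hf : Torus.IsSmooth f) {ω : Path (Fin 3)} (hω : ω ∈ pathSpace R L) (t : ℝ) :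
    |∑' k : Fin 3 → ℤ, (inner ℂ (mFourierCoeff (EuclideanSpace.complexify ∘ f) k) (pathExt ω t k)).re| ≤
      (∑' k : Fin 3 → ℤ, ‖mFourierCoeff (EuclideanSpace.complexify ∘ f) k‖) * |R| := by
  have hs := Torus.summable_norm_mFourierCoeff_of_isSmooth hf
  have hle : ∀ k : Fin 3 → ℤ,
      ‖(inner ℂ (mFourierCoeff (EuclideanSpace.complexify ∘ f) k) (pathExt ω t k)).re‖ ≤
        ‖mFourierCoeff (EuclideanSpace.complexify ∘ f) k‖ * |R| := by
    intro k
    rw [Real.norm_eq_abs]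
    calc |(inner ℂ (mFourierCoeff (EuclideanSpace.complexify ∘ f) k) (pathExt ω t k)).re|
        ≤ ‖inner ℂ (mFourierCoeff (EuclideanSpace.complexify ∘ f) k) (pathExt ω t k)‖ :=
          Complex.abs_re_le_norm _
      _ ≤ ‖mFourierCoeff (EuclideanSpace.complexify ∘ f) k‖ * ‖pathExt ω t k‖ := norm_inner_le_norm _ _
      _ ≤ ‖mFourierCoeff (EuclideanSpace.complexify ∘ f) k‖ * |R| :=
          mul_le_mul_of_nonneg_left (norm_pathExt_le hω t k) (norm_nonneg _)
  have hsum : Summable fun k : Fin 3 → ℤ => ‖mFourierCoeff (EuclideanSpace.complexify ∘ f) k‖ * |R| :=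
    hs.mul_right |R|
  rw [← Real.norm_eq_abs, ← tsum_mul_right]
  exact tsum_of_norm_bounded hsum.hasSum hle

/-- The work integrand of a path of `𝒦` is continuous in time. -/
theorem continuous_workIntegrand_time (hf : Torus.IsSmooth f) {ω : Path (Fin 3)} (hω : ω ∈ pathSpace R L) :
    Continuous fun t : ℝ => ∑' k : Fin 3 → ℤ,
      (inner ℂ (mFourierCoeff (EuclideanSpace.complexify ∘ f) k) (pathExt ω t k)).re := by
  have h := (LimitLawDefect.continuous_workIntegrand hf R L).comp
    (Continuous.prodMk_right (⟨ω, hω⟩ : ↥(pathSpace R L)))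
  exact h

/-- The work integrand of a path of `𝒦` is interval integrable on every interval. -/
theorem intervalIntegrable_workIntegrand (hf : Torus.IsSmooth f) {ω : Path (Fin 3)} (hω : ω ∈ pathSpace R L)
    (a b : ℝ) : IntervalIntegrable (fun t : ℝ => ∑' k : Fin 3 → ℤ,
      (inner ℂ (mFourierCoeff (EuclideanSpace.complexify ∘ f) k) (pathExt ω t k)).re) volume a b :=
  (continuous_workIntegrand_time hf hω).intervalIntegrable a b

/-- **The work functional along the shift**: `W(θⁱω) = ∫ᵢ^{i+1} Σ'_k Re⟪𝓕f k, ω̄(t,k)⟫ dt`. -/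
theorem workMean_iterate_pathShift {ω : Path (Fin 3)} (hω : ω ∈ pathSpace R L) (i : ℕ) :
    (∫ t in (0 : ℝ)..1, ∑' k : Fin 3 → ℤ,
      (inner ℂ (mFourierCoeff (EuclideanSpace.complexify ∘ f) k) (pathExt (pathShift^[i] ω) t k)).re) =
    ∫ t in (i : ℝ)..(i + 1 : ℕ), ∑' k : Fin 3 → ℤ,
      (inner ℂ (mFourierCoeff (EuclideanSpace.complexify ∘ f) k) (pathExt ω t k)).re := by
  have heq : ∀ t ∈ uIcc (0 : ℝ) 1, (∑' k : Fin 3 → ℤ,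
      (inner ℂ (mFourierCoeff (EuclideanSpace.complexify ∘ f) k) (pathExt (pathShift^[i] ω) t k)).re) =
      ∑' k : Fin 3 → ℤ,
        (inner ℂ (mFourierCoeff (EuclideanSpace.complexify ∘ f) k) (pathExt ω (t + i) k)).re := by
    intro t ht
    rw [uIcc_of_le zero_le_one] at ht
    simp_rw [pathExt_iterate_pathShift hω i ht.1]
  rw [intervalIntegral.integral_congr heq, intervalIntegral.integral_comp_add_right (fun t => ∑' k : Fin 3 → ℤ,
      (inner ℂ (mFourierCoeff (EuclideanSpace.complexify ∘ f) k) (pathExt ω t k)).re)]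
  push_cast
  rw [zero_add, add_comm]

/-- **Birkhoff sums of the work functional**: `Σ_{i<n} W(θⁱω) = ∫₀ⁿ Σ'_k Re⟪𝓕f k, ω̄(t,k)⟫ dt`. -/
theorem birkhoffSum_workMean (hf : Torus.IsSmooth f) (ω : ↥(pathSpace R L)) (n : ℕ) :
    birkhoffSum (pathShiftOn R L (pathShift_mapsTo R L)) (fun ω' : ↥(pathSpace R L) =>
      ∫ t in (0 : ℝ)..1, ∑' k : Fin 3 → ℤ,
        (inner ℂ (mFourierCoeff (EuclideanSpace.complexify ∘ f) k) (pathExt ω'.1 t k)).re) n ω =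
    ∫ t in (0 : ℝ)..n, ∑' k : Fin 3 → ℤ,
      (inner ℂ (mFourierCoeff (EuclideanSpace.complexify ∘ f) k) (pathExt ω.1 t k)).re := by
  rw [birkhoffSum]
  refine sum_range_eq_intervalIntegral (fun i => ?_) (intervalIntegrable_workIntegrand hf ω.2) n
  rw [coe_iterate_pathShiftOn, workMean_iterate_pathShift ω.2]

/-! ### The full (unit-viscosity) dissipation functional `Gₑ = ⨆_K ofReal (dissMean 1 K ·)` -/

/-- The unit-window resolved dissipation scales linearly with the viscosity. -/
theorem dissMean_eq_mul_dissMean_one (ν : ℝ) (K : ℕ) (ω : Path (Fin 3)) :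
    dissMean ν K ω = ν * dissMean 1 K ω := by
  unfold dissMean
  rw [← intervalIntegral.integral_const_mul]
  exact intervalIntegral.integral_congr fun t _ => RealisedStrictInequality.pathDiss_eq_mul_pathDiss_one ν K ω t

/-- The unit-window resolved dissipation is monotone in the cutoff on `𝒦`. -/
theorem dissMean_one_mono {ω : Path (Fin 3)} (hω : ω ∈ pathSpace R L) :
    Monotone fun K : ℕ => dissMean 1 K ω := by
  intro K K' hKK'
  unfold dissMean
  exact intervalIntegral.integral_mono_on zero_le_one (intervalIntegrable_pathDiss hω 1 K 0 1)
    (intervalIntegrable_pathDiss hω 1 K' 0 1)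
    fun t _ => RealisedStrictInequality.pathDiss_mono_cutoff zero_le_one hKK' ω t

/-- `Gₑ` is measurable on `𝒦`. -/
theorem measurable_iSup_ofReal_dissMean (R : ℝ) (L : (Fin 3 → ℤ) → ℝ) :
    Measurable fun ω : ↥(pathSpace R L) => ⨆ K : ℕ, ENNReal.ofReal (dissMean 1 K ω.1) :=
  Measurable.iSup fun K => ENNReal.measurable_ofReal.comp (continuous_dissMean R L 1 K).measurable

/-- **Monotone convergence for `Gₑ`**: `∫⁻ Gₑ dQ = ⨆_K ofReal (∫ dissMean 1 K dQ)` for a finite measure `Q`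
on `𝒦`. -/
theorem lintegral_iSup_ofReal_dissMean (Q : Measure ↥(pathSpace R L)) [IsFiniteMeasure Q] :
    ∫⁻ ω, (⨆ K : ℕ, ENNReal.ofReal (dissMean 1 K ω.1)) ∂Q =
      ⨆ K : ℕ, ENNReal.ofReal (∫ ω, dissMean 1 K ω.1 ∂Q) := by
  haveI : CompactSpace ↥(pathSpace R L) := compactSpace_pathSpace R L
  have hmeas : ∀ K : ℕ, Measurable fun ω : ↥(pathSpace R L) =>
      ENNReal.ofReal (dissMean 1 K ω.1) := fun K =>
    ENNReal.measurable_ofReal.comp (continuous_dissMean R L 1 K).measurable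
  have hmono : Monotone fun K : ℕ => fun ω : ↥(pathSpace R L) =>
      ENNReal.ofReal (dissMean 1 K ω.1) := fun K K' hKK' ω =>
    ENNReal.ofReal_le_ofReal (dissMean_one_mono ω.2 hKK')
  rw [lintegral_iSup hmeas hmono]
  refine iSup_congr fun K => ?_
  have hint : Integrable (fun ω : ↥(pathSpace R L) => dissMean 1 K ω.1) Q :=
    (continuous_dissMean R L 1 K).integrable_of_hasCompactSupport (HasCompactSupport.of_compactSpace _)
  rw [← ofReal_integral_eq_lintegral_ofReal hint
    (ae_of_all _ fun ω => (dissMean_mem_Icc zero_le_one K ω.2).1)]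

/-- **`Gₑ` along the shift**: `Gₑ(θⁱω) = ⨆_K ofReal (∫ᵢ^{i+1} pathDiss 1 K ω)`. -/
theorem iSup_ofReal_dissMean_iterate_pathShift {ω : Path (Fin 3)} (hω : ω ∈ pathSpace R L) (i : ℕ) :
    (⨆ K : ℕ, ENNReal.ofReal (dissMean 1 K (pathShift^[i] ω))) =
      ⨆ K : ℕ, ENNReal.ofReal (∫ t in (i : ℝ)..(i + 1 : ℕ), pathDiss 1 K ω t) :=
  iSup_congr fun K => by rw [dissMean_iterate_pathShift hω 1 K i]

/-- **The window inequality**: `⨆_K ofReal (∫₀ᵐ pathDiss 1 K ω) ≤ Σ_{i<m} Gₑ(θⁱω)` on `𝒦` (split `[0, m]` into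
unit windows; the supremum of a sum is at most the sum of the suprema). -/
theorem iSup_ofReal_intervalIntegral_pathDiss_le_sum {ω : Path (Fin 3)} (hω : ω ∈ pathSpace R L) (m : ℕ) :
    (⨆ K : ℕ, ENNReal.ofReal (∫ t in (0 : ℝ)..m, pathDiss 1 K ω t)) ≤
      ∑ i ∈ Finset.range m, ⨆ K : ℕ, ENNReal.ofReal (dissMean 1 K (pathShift^[i] ω)) := by
  refine iSup_le fun K => ?_
  have hsplit : (∫ t in (0 : ℝ)..m, pathDiss 1 K ω t) =
      ∑ i ∈ Finset.range m, ∫ t in (i : ℝ)..(i + 1 : ℕ), pathDiss 1 K ω t :=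
    (sum_range_eq_intervalIntegral (G := fun i : ℕ => ∫ t in (i : ℝ)..(i + 1 : ℕ), pathDiss 1 K ω t)
      (fun _ => rfl) (intervalIntegrable_pathDiss hω 1 K) m).symm
  have hnn : ∀ i ∈ Finset.range m, 0 ≤ ∫ t in (i : ℝ)..(i + 1 : ℕ), pathDiss 1 K ω t := fun i _ =>
    intervalIntegral.integral_nonneg (by push_cast; linarith) fun t _ => pathDiss_nonneg zero_le_one K ω t
  rw [hsplit, ENNReal.ofReal_sum_of_nonneg hnn]
  refine Finset.sum_le_sum fun i _ => ?_
  rw [iSup_ofReal_dissMean_iterate_pathShift hω i]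
  exact le_iSup (fun K : ℕ => ENNReal.ofReal (∫ t in (i : ℝ)..(i + 1 : ℕ), pathDiss 1 K ω t)) K

/-! ### Running means of a field realising a path -/

/-- **Work along a realised path, pointwise**: if `u t ∈ L²` and `𝓕(u t) = ω̄(s + t, ·)`, then
`∫⟪f, u t⟫ = Σ'_k Re⟪𝓕f k, ω̄(s+t,k)⟫` (Parseval, `hasSum_re_inner_mFourierCoeff_complexify`). -/
theorem integral_inner_eq_workIntegrand (hf : MemLp f 2 volume) {ω : Path (Fin 3)} {s t : ℝ}
    {v : UnitAddTorus (Fin 3) → EuclideanSpace ℝ (Fin 3)} (hv : MemLp v 2 volume)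
    (hcoef : ∀ k, mFourierCoeff (EuclideanSpace.complexify ∘ v) k = pathExt ω (s + t) k) :
    ∫ x, ⟪f x, v x⟫_ℝ = ∑' k : Fin 3 → ℤ,
      (inner ℂ (mFourierCoeff (EuclideanSpace.complexify ∘ f) k) (pathExt ω (s + t) k)).re := by
  rw [← (hasSum_re_inner_mFourierCoeff_complexify hf hv).tsum_eq]
  exact tsum_congr fun k => by rw [hcoef k]

/-- **The running means of the work converge to the Birkhoff limit of the work functional.** Let `u`
realise `ω ∈ 𝒦` after the shift `s ≥ 0` (`u t ∈ L²`, `𝓕(u t) = ω̄(s+t,·)` for `t ≥ 0`). If the integer-window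
means `n⁻¹ ∫₀ⁿ Σ'_k Re⟪𝓕f k, ω̄(t,k)⟫ dt` converge to `w`, then `timeMean (∫⟪f, u ·⟫) T → w` as `T → ∞`
(shift the bounded integrand by the constant `(Σ'‖𝓕f k‖)|R|` to make it nonnegative, upgrade integer windows to
all windows, translate by `s`, Parseval). -/
theorem tendsto_timeMean_work (hf : Torus.IsSmooth f) {ω : Path (Fin 3)} (hω : ω ∈ pathSpace R L)
    {s : ℝ} (hs : 0 ≤ s) {u : ℝ → UnitAddTorus (Fin 3) → EuclideanSpace ℝ (Fin 3)}
    (hu : ∀ t, 0 ≤ t → MemLp (u t) 2 volume ∧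
      ∀ k, mFourierCoeff (EuclideanSpace.complexify ∘ u t) k = pathExt ω (s + t) k)
    {w : ℝ} (hw : Tendsto (fun n : ℕ => (n : ℝ)⁻¹ * ∫ t in (0 : ℝ)..n, ∑' k : Fin 3 → ℤ,
      (inner ℂ (mFourierCoeff (EuclideanSpace.complexify ∘ f) k) (pathExt ω t k)).re) atTop (𝓝 w)) :
    Tendsto (timeMean fun t => ∫ x, ⟪f x, u t x⟫_ℝ) atTop (𝓝 w) := by
  -- the work integrand and its nonnegative shift
  set Wi : ℝ → ℝ := fun t => ∑' k : Fin 3 → ℤ,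
    (inner ℂ (mFourierCoeff (EuclideanSpace.complexify ∘ f) k) (pathExt ω t k)).re with hWi
  set C : ℝ := (∑' k : Fin 3 → ℤ, ‖mFourierCoeff (EuclideanSpace.complexify ∘ f) k‖) * |R| with hC
  set g : ℝ → ℝ := fun t => Wi t + C with hg
  have hg0 : ∀ t, 0 ≤ g t := fun t => by
    have h := abs_workIntegrand_le hf hω t
    rw [abs_le] at h
    simp only [hg, hWi]
    linarith [h.1]
  have hWi_int : ∀ a b : ℝ, IntervalIntegrable Wi volume a b := intervalIntegrable_workIntegrand hf hω
  have hgi : ∀ a b : ℝ, IntervalIntegrable g volume a b := fun a b =>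
    (hWi_int a b).add intervalIntegrable_const
  -- integer windows for `g`
  have h1 : Tendsto (fun n : ℕ => (n : ℝ)⁻¹ * ∫ t in (0 : ℝ)..n, g t) atTop (𝓝 (w + C)) := by
    refine (hw.add_const C).congr' ?_
    filter_upwards [eventually_ge_atTop 1] with n hn
    have hn0 : (n : ℝ) ≠ 0 := by exact_mod_cast (Nat.one_le_iff_ne_zero.1 hn)
    rw [hg, intervalIntegral.integral_add (hWi_int 0 n) intervalIntegrable_const,
      intervalIntegral.integral_const, sub_zero, smul_eq_mul, mul_add, inv_mul_cancel_left₀ hn0]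
  -- all windows, then the shift by `s`
  have h2 : Tendsto (timeMean g) atTop (𝓝 (w + C)) := tendsto_timeMean_of_nat hg0 hgi h1
  have h3 : Tendsto (timeMean fun t => g (s + t)) atTop (𝓝 (w + C)) := tendsto_timeMean_comp_add hgi h2 hs
  have h4 : Tendsto (fun T => timeMean (fun t => g (s + t)) T - C) atTop (𝓝 (w + C - C)) := h3.sub_const C
  rw [add_sub_cancel_right] at h4
  refine h4.congr' ?_
  filter_upwards [eventually_gt_atTop 0] with T hT
  have hT0 : T ≠ 0 := hT.ne'
  -- Parseval on `[0, T]`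
  have heq : ∀ t ∈ uIcc (0 : ℝ) T, ∫ x, ⟪f x, u t x⟫_ℝ = Wi (s + t) := by
    intro t ht
    rw [uIcc_of_le hT.le] at ht
    exact integral_inner_eq_workIntegrand (hf.memLp 2) (hu t ht.1).1 (hu t ht.1).2
  have hWis_int : IntervalIntegrable (fun t => Wi (s + t)) volume 0 T :=
    ((continuous_workIntegrand_time hf hω).comp (continuous_const.add continuous_id)).intervalIntegrable 0 T
  rw [timeMean, timeMean, intervalIntegral.integral_congr heq]
  simp only [hg]
  rw [intervalIntegral.integral_add hWis_int intervalIntegrable_const, intervalIntegral.integral_const,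
    sub_zero, smul_eq_mul, mul_add, inv_mul_cancel_left₀ hT0, add_sub_cancel_right]

/-- **The running means of the dissipation of a realised path are dominated by the Birkhoff sums of `Gₑ`.**
Let `𝓕(u t) = ω̄(s + t, ·)` for `t ≥ 0` (`ω ∈ 𝒦`, `s ≥ 0`), `ν ≥ 0`, `T > 0` and `s + T ≤ m`. If
`Gₑ(θⁱω) < ∞` for `i < m`, then `timeMean (ν‖∇u(·)‖₂²) T ≤ ν T⁻¹ Σ_{i<m} Gₑ(θⁱω).toReal`
(`lintegral_eGradNormSq_pathField`, the window inequality, and exactness of `toReal` at finite values). -/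
theorem timeMean_dissipation_le {ν : ℝ} (hν : 0 ≤ ν) {ω : Path (Fin 3)} (hω : ω ∈ pathSpace R L)
    {s : ℝ} (hs : 0 ≤ s) {u : ℝ → UnitAddTorus (Fin 3) → EuclideanSpace ℝ (Fin 3)}
    (hcoef : ∀ t, 0 ≤ t → ∀ k, mFourierCoeff (EuclideanSpace.complexify ∘ u t) k = pathExt ω (s + t) k)
    {T : ℝ} (hT : 0 < T) {m : ℕ} (hm : s + T ≤ m)
    (hfin : ∀ i ∈ Finset.range m, (⨆ K : ℕ, ENNReal.ofReal (dissMean 1 K (pathShift^[i] ω))) ≠ ⊤) :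
    timeMean (fun t => ν * (eGradNormSq (u t)).toReal) T ≤
      ν * (T⁻¹ * ∑ i ∈ Finset.range m, (⨆ K : ℕ, ENNReal.ofReal (dissMean 1 K (pathShift^[i] ω))).toReal) := by
  -- the enstrophy of the realised field over `(0, T)` in terms of the path
  have hD : ∫⁻ τ in Ioo 0 T, eGradNormSq (u τ) =
      ⨆ K : ℕ, ENNReal.ofReal (∫ t in s..(s + T), pathDiss 1 K ω t) := by
    have h := RealisedStrictInequality.lintegral_eGradNormSq_pathField hω hcoef le_rfl hT.le
    rwa [add_zero] at h
  -- the window inequality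
  have hle : (⨆ K : ℕ, ENNReal.ofReal (∫ t in s..(s + T), pathDiss 1 K ω t)) ≤
      ∑ i ∈ Finset.range m, ⨆ K : ℕ, ENNReal.ofReal (dissMean 1 K (pathShift^[i] ω)) := by
    refine le_trans (iSup_mono fun K => ENNReal.ofReal_le_ofReal ?_)
      (iSup_ofReal_intervalIntegral_pathDiss_le_sum hω m)
    exact intervalIntegral.integral_mono_interval hs (by linarith) hm
      (ae_of_all _ fun t => pathDiss_nonneg zero_le_one K ω t) (intervalIntegrable_pathDiss hω 1 K 0 m)
  have hsum_ne : ∑ i ∈ Finset.range m, (⨆ K : ℕ, ENNReal.ofReal (dissMean 1 K (pathShift^[i] ω))) ≠ ⊤ :=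
    ENNReal.sum_ne_top.2 hfin
  have hDne : ∫⁻ τ in Ioo 0 T, eGradNormSq (u τ) ≠ ⊤ := by
    rw [hD]; exact ne_top_of_le_ne_top hsum_ne hle
  -- exactness of `toReal`
  have hmeas : AEMeasurable (fun t => eGradNormSq (u t)) (volume.restrict (Ioo 0 T)) :=
    aemeasurable_eGradNormSq_pathField hω hcoef (fun t ht => ht.1.le) measurableSet_Ioo
  have hlt : ∀ᵐ τ ∂(volume.restrict (Ioo 0 T)), eGradNormSq (u τ) < ⊤ := ae_lt_top' hmeas hDne
  have hint : ∫ t in (0 : ℝ)..T, (eGradNormSq (u t)).toReal = (∫⁻ τ in Ioo 0 T, eGradNormSq (u τ)).toReal := by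
    rw [intervalIntegral.integral_of_le hT.le, integral_Ioc_eq_integral_Ioo, integral_toReal hmeas hlt]
  have hreal : (∫⁻ τ in Ioo 0 T, eGradNormSq (u τ)).toReal ≤
      ∑ i ∈ Finset.range m, (⨆ K : ℕ, ENNReal.ofReal (dissMean 1 K (pathShift^[i] ω))).toReal := by
    rw [← ENNReal.toReal_sum hfin]
    exact ENNReal.toReal_mono hsum_ne (hD ▸ hle)
  unfold timeMean
  rw [intervalIntegral.integral_const_mul, hint, mul_left_comm]
  exact mul_le_mul_of_nonneg_left (mul_le_mul_of_nonneg_left hreal (inv_nonneg.2 hT.le)) hν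

/-! ### A comparison principle for `longTimeAvgSup` with a moving bound -/

/-- If eventually `b ≤ timeMean h T ≤ φ T` and `φ T → ℓ`, then `longTimeAvgSup h ≤ ℓ`. -/
theorem longTimeAvgSup_le_of_le_of_tendsto {h : ℝ → ℝ} {φ : ℝ → ℝ} {ℓ b : ℝ}
    (hB : ∀ᶠ T in atTop, timeMean h T ≤ φ T) (hφ : Tendsto φ atTop (𝓝 ℓ))
    (hb : ∀ᶠ T in atTop, b ≤ timeMean h T) : longTimeAvgSup h ≤ ℓ := by
  rw [longTimeAvgSup, ← hφ.limsup_eq]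
  exact limsup_le_limsup hB (isBoundedUnder_of_eventually_ge hb).isCoboundedUnder_le hφ.isBoundedUnder_le


/-! ### A ceiling ratio -/

/-- `⌈s + T⌉₊ / T → 1` as `T → ∞`. -/
theorem tendsto_natCeil_add_div (s : ℝ) :
    Tendsto (fun T : ℝ => (⌈s + T⌉₊ : ℝ) / T) atTop (𝓝 1) := by
  have h0 : Tendsto (fun T : ℝ => T⁻¹) atTop (𝓝 0) := tendsto_inv_atTop_zero
  have hlow : Tendsto (fun T : ℝ => (s + T) / T) atTop (𝓝 1) := by
    have : Tendsto (fun T : ℝ => s * T⁻¹ + 1) atTop (𝓝 (s * 0 + 1)) := (h0.const_mul s).add_const 1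
    rw [mul_zero, zero_add] at this
    refine this.congr' ?_
    filter_upwards [eventually_gt_atTop 0] with T hT
    field_simp
  have hup : Tendsto (fun T : ℝ => (s + T + 1) / T) atTop (𝓝 1) := by
    have : Tendsto (fun T : ℝ => (s + 1) * T⁻¹ + 1) atTop (𝓝 ((s + 1) * 0 + 1)) :=
      (h0.const_mul (s + 1)).add_const 1
    rw [mul_zero, zero_add] at this
    refine this.congr' ?_
    filter_upwards [eventually_gt_atTop 0] with T hT
    field_simp
    ring
  refine tendsto_of_tendsto_of_tendsto_of_le_of_le' hlow hup ?_ ?_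
  · filter_upwards [eventually_gt_atTop 0] with T hT
    exact div_le_div_of_nonneg_right (Nat.le_ceil (s + T)) hT.le
  · filter_upwards [eventually_gt_atTop 0, eventually_gt_atTop (-s)] with T hT hsT
    have hsT' : 0 ≤ s + T := by linarith
    exact div_le_div_of_nonneg_right (Nat.ceil_lt_add_one hsT').le hT.le

/-! ### S18 · the long-time means of a field realising a generic path -/

/-- **S18 · `stub_meansOfRealisation` — long-time means of a field realising a generic path.** Let `u`
realise `ω ∈ 𝒦 = pathSpace R L` after the shift `s ≥ 0` (`u t ∈ L²`, `𝓕(u t) = ω̄(s+t, ·)` for `t ≥ 0`), let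
the integer-window means of the work integrand `Σ'_k Re⟪𝓕f k, ω̄(t,k)⟫` converge to `w`, the Birkhoff
averages of the full unit-viscosity dissipation functional `G = (⨆_K ofReal dissMean 1 K)·toReal` along the
orbit of `ω` converge to `g`, and `G` be finite along the orbit. Then `longTimeAvgSup (∫⟪f, u ·⟫) = w`
(`tendsto_timeMean_work`) and `meanDissipation ν u ≤ ν g` (`timeMean_dissipation_le` with the moving window
`m = ⌈s + T⌉₊`, `⌈s+T⌉₊/T → 1`, comparison principle). [folklore; FMRTTurbulence2001 Ch. IV App. B;
DoeringFoias2002 §2] -/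
theorem stub_meansOfRealisation :
    ∀ (R : ℝ) (L : (Fin 3 → ℤ) → ℝ) (f : UnitAddTorus (Fin 3) → EuclideanSpace ℝ (Fin 3)),
      Torus.IsSmooth f → ∀ (ν : ℝ), 0 ≤ ν →
    ∀ (ω : ℚ × (Fin 3 → ℤ) → EuclideanSpace ℂ (Fin 3)), ω ∈ pathSpace R L →
    ∀ (s : ℝ), 0 ≤ s →
    ∀ (u : ℝ → UnitAddTorus (Fin 3) → EuclideanSpace ℝ (Fin 3)),
      (∀ t : ℝ, 0 ≤ t → MemLp (u t) 2 volume ∧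
        ∀ k : Fin 3 → ℤ, mFourierCoeff (EuclideanSpace.complexify ∘ u t) k = pathExt ω (s + t) k) →
    ∀ (w g : ℝ),
      Tendsto (fun m : ℕ => (m : ℝ)⁻¹ * ∫ t in (0 : ℝ)..m, ∑' k : Fin 3 → ℤ,
        (inner ℂ (mFourierCoeff (EuclideanSpace.complexify ∘ f) k) (pathExt ω t k)).re) atTop (𝓝 w) →
      Tendsto (fun m : ℕ => (m : ℝ)⁻¹ * ∑ i ∈ Finset.range m,
        (⨆ K : ℕ, ENNReal.ofReal (dissMean 1 K (pathShift^[i] ω))).toReal) atTop (𝓝 g) →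
      (∀ i : ℕ, (⨆ K : ℕ, ENNReal.ofReal (dissMean 1 K (pathShift^[i] ω))) ≠ ⊤) →
      longTimeAvgSup (fun t => ∫ y, ⟪f y, u t y⟫_ℝ) = w ∧ meanDissipation ν u ≤ ν * g := by
  intro R L f hf ν hν ω hω s hs u hu w g hw hg hfin
  have hcoef : ∀ t, 0 ≤ t → ∀ k, mFourierCoeff (EuclideanSpace.complexify ∘ u t) k =
      pathExt ω (s + t) k := fun t ht => (hu t ht).2
  refine ⟨longTimeAvgSup_eq_of_tendsto (tendsto_timeMean_work hf hω hs hu hw), ?_⟩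
  -- dissipation: running means are dominated by moving Birkhoff averages of `G`, which tend to `g`
  have hbound : ∀ᶠ T in atTop, timeMean (fun t => ν * (eGradNormSq (u t)).toReal) T ≤
      ν * (T⁻¹ * ∑ i ∈ Finset.range ⌈s + T⌉₊,
        (⨆ K : ℕ, ENNReal.ofReal (dissMean 1 K (pathShift^[i] ω))).toReal) := by
    filter_upwards [eventually_gt_atTop 0] with T hT
    exact timeMean_dissipation_le hν hω hs hcoef hT (m := ⌈s + T⌉₊) (Nat.le_ceil _) fun i _ => hfin i
  have hb : ∀ᶠ T in atTop, (0 : ℝ) ≤ timeMean (fun t => ν * (eGradNormSq (u t)).toReal) T := by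
    filter_upwards [eventually_gt_atTop 0] with T hT
    exact mul_nonneg (inv_nonneg.2 hT.le)
      (intervalIntegral.integral_nonneg hT.le fun t _ => mul_nonneg hν ENNReal.toReal_nonneg)
  have hφT : Tendsto (fun T : ℝ => ν * (T⁻¹ * ∑ i ∈ Finset.range ⌈s + T⌉₊,
      (⨆ K : ℕ, ENNReal.ofReal (dissMean 1 K (pathShift^[i] ω))).toReal)) atTop (𝓝 (ν * g)) := by
    have hmT : Tendsto (fun T : ℝ => ⌈s + T⌉₊) atTop atTop :=
      tendsto_nat_ceil_atTop.comp (tendsto_atTop_add_const_left atTop s tendsto_id)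
    have hBA := hg.comp hmT
    have hprod := (tendsto_natCeil_add_div s).mul hBA
    rw [one_mul] at hprod
    refine (hprod.const_mul ν).congr' ?_
    filter_upwards [eventually_gt_atTop 0, eventually_gt_atTop (-s)] with T hT hsT
    have hm0 : (⌈s + T⌉₊ : ℝ) ≠ 0 := by
      have : 0 < ⌈s + T⌉₊ := Nat.ceil_pos.2 (by linarith)
      exact_mod_cast this.ne'
    have key : ∀ S : ℝ, ν * ((⌈s + T⌉₊ : ℝ) / T * ((((⌈s + T⌉₊ : ℕ) : ℝ))⁻¹ * S)) = ν * (T⁻¹ * S) := by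
      intro S
      rw [show ν * ((⌈s + T⌉₊ : ℝ) / T * ((((⌈s + T⌉₊ : ℕ) : ℝ))⁻¹ * S)) =
          ν * (T⁻¹ * S) * ((⌈s + T⌉₊ : ℝ) * ((⌈s + T⌉₊ : ℝ))⁻¹) by ring, mul_inv_cancel₀ hm0, mul_one]
    simp only [comp_apply]
    exact key _
  unfold meanDissipation
  exact longTimeAvgSup_le_of_le_of_tendsto hbound hφT hb

end Summit.AnomalousDissipation.AnomalousDissipation.Theorems.MomentParityResolvedDissipation.NoMeanLeakageBridge

end
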